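import Summits.AtomisticToContinuum.HydrodynamicLimit.Theses.JParityClosure
import Summits.AtomisticToContinuum.HydrodynamicLimit.Theses.ImplosionDichotomy
import Summits.AtomisticToContinuum.HydrodynamicLimit.Theorems.DensityCap.Negative.MollifiedDensity
import Summits.AtomisticToContinuum.HydrodynamicLimit.Theorems.DensityCap.Negative.Equilibrium
import Summits.AtomisticToContinuum.HydrodynamicLimit.Theorems.DensityCap.Negative.Packing
import Summits.AtomisticToContinuum.HydrodynamicLimit.Theorems.JParityClosureDensityCapMeanDisplacement
import Summits.AtomisticToContinuum.HydrodynamicLimit.Theorems.JParityClosureDensityCapEulerDensityModulus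
import Summits.AtomisticToContinuum.HydrodynamicLimit.Theorems.JParityClosureDensityCapGridUpgrade
import HarnessLib

/-!
# `DensityCap` closed modulo the band limit: the line `lipschitz-clock-free-past-cap` composed

Crux `JParityClosure.DensityCap` (stmt-AtomisticToContinuum-13082): NO OVERCOMPRESSION BEFORE THE
SHOCK — for continuous positive profiles, all small `σ`, every classical hard-sphere-Euler solution
`(ρ, u, θ)` on `[0, T)` tied at `t = 0` to the local Gibbs data through the flow family `Φ`, every
`t < T` and `η, δ > 0`: for all small `r` and then all large `N`, the local Gibbs probability that the
`r`-mollified empirical density exceeds `ρ + η` somewhere on `[0, t] × 𝕋³` is at most `δ`.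

This file composes the four landed stubs of the line (`stub_meanDisplacement`,
`stub_eulerDensityModulus`, `stub_capEventSubset` inside `stub_gridUpgrade`) into:

* `capLimit_of_densityLLN` — THE PER-INSTANCE UPGRADE every dock shares: for ONE tied classical
  solution, the fixed-time density law of large numbers at every `s ∈ [0, t]` implies the cap on
  `[0, t]` (`CapLimit`, verbatim the crux's conclusion block). Inputs: the mean displacement bound
  (stub A), the `χ ≡ 1` energy instance of the tie (`energyTight_of_tie`), the modulus of the smooth
  Euler density (stub B), the grid upgrade (stub E).
* `DensityCap_of : HydroLimitInBand → DiluteSelfConsistency → DensityCap` — the crux from the two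
  SHARED ITEMS stmt-9133 (packing-guarded hydrodynamic limit) and stmt-3091 (guard removal),
  by pure quantifier bookkeeping (`σ₀ := min σ₁ σ₃`). CONDITIONAL on those two items, which carry the
  whole dynamical content: the crux is EQUIVALENT to the density third of the conjunct uniformly in
  time (disprover / triage finding; unguarded surplus = `packingBandAt_of_densityCap`, Negative side).
  (`DiluteSelfConsistency` is read through the record below of the dropped JParityClosure copy; the
  item lives on as `ImplosionDichotomy.DiluteSelfConsistency` etc.)
* `densityCap_of_hydrodynamicLimit_of_diluteSelfConsistency : HydrodynamicLimit → DiluteSelfConsistency →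
  DensityCap` and `densityCapGuarded_of_hydrodynamicLimit : HydrodynamicLimit → (guarded cap)` — the
  corollary status of the crux AFTER the Statement re-type D-0032 (2026-08-16: `HydrodynamicLimit` is now
  the packing-GUARDED conjunct, verbatim `HydroLimitInBand`): from the conjunct ALONE one gets the guarded
  cap; the unguarded crux needs guard removal (stmt-3091) on top. The pre-re-type corollary
  `densityCap_of_hydrodynamicLimit : HydrodynamicLimit → DensityCap` (unguarded conjunct ⇒ crux) is kept
  as a DEPRECATED alias of the first — its text no longer says what it said.
* `densityCapGuarded_of_hydroLimitInBand` — the 3091-FREE content: the packing-GUARDED cap from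
  stmt-9133 alone (the form the glue `ParityInBand` actually consumes; since the re-type, the form the
  conjunct itself delivers).
* `capLimit_homogeneous` — UNCONDITIONAL: the cap holds at global equilibrium (profiles `(1, 1, 0)`,
  tied constant state `(1, 0, 1)`) at every `t ≥ 0`, closing the disprover's second §6 near-miss: the
  equilibrium fields converge at every time (`tendstoHydroFieldsAt_homogeneous`, flow invariance of the
  homogeneous law), and `capLimit_of_densityLLN` upgrades them.
* `uniformL1_of_densityCap` — THE CONVERSE DIRECTION (mass squeeze, card `equal-mass-two-sided-dock` /
  triage r1): by EQUAL MASS (`∫ ρ̄ʳ = 1`, `integral_mollDensity_eq_one`; `∫ ρ(s) = 1`, continuity equation +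
  the `χ ≡ 1` tie) the one-sided cap is the two-sided, uniform-in-time `L¹` density law of large numbers:
  `DensityCap` ⇒ `P_N(∃ s ≤ t, ‖ρ̄ʳ(Φ_N(s)·) − ρ(s)‖_{L¹} > 2η) ≤ δ` eventually. So the crux is EXACTLY the
  density third of the conjunct, uniformly in time — neither weaker nor stronger.

No new definition is introduced (statements over `DensityCapNegative.{CapLimit, capEvent, mollDensity,
cone}` and the tree's `TendstoHydroFieldsAt`, `localGibbsLaw`, `configEnergy`).

References: H. Spohn, *Large Scale Dynamics of Interacting Particles* (1991), Part I Ch. 3;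
S. Olla, S. R. S. Varadhan, H.-T. Yau, Comm. Math. Phys. 155 (1993), §1; C. Kipnis, C. Landim,
*Scaling Limits of Interacting Particle Systems* (1999), Ch. 4.

Maintenance record (full-build repair, 2026-08-17; dependency drift after the Statement re-type p126922 /
D-0032). (1) Route JParityClosure rev 3 (2026-08-16T23:22Z) DROPPED its copy of the shared crux
`DiluteSelfConsistency` (stmt-3091; the guard is now a hypothesis of the Statement), so
`Theses.JParityClosure.DiluteSelfConsistency`, named in the signature of `DensityCap_of`, stopped resolving
(152:10); the shared item itself is OPEN and unchanged (live copies `ImplosionDichotomy.DiluteSelfConsistency`,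
…): its statement is RECORDED below under the dropped copy's exact former name, VERBATIM (ledger signature
of stmt-3091, string-equal to the ImplosionDichotomy copy), so `DensityCap_of` keeps signature and proof
byte-for-byte. (2) `_root_.HydrodynamicLimit` was re-typed to the packing-guarded conjunct, so the
pre-re-type corollary `densityCap_of_hydrodynamicLimit : HydrodynamicLimit → DensityCap` no longer elaborates
(175) and, read against the new Statement, is no longer bookkeeping (it would remove the guard); append-only:
it becomes a deprecated alias of the honest re-typed corollary
`densityCap_of_hydrodynamicLimit_of_diluteSelfConsistency`, and the guard-keeping corollary
`densityCapGuarded_of_hydrodynamicLimit` is added. Everything else is unchanged.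
-/

noncomputable section

/-! ## Record of the dropped JParityClosure copy of the shared crux `DiluteSelfConsistency` (stmt-3091) -/

namespace Summit.AtomisticToContinuum.HydrodynamicLimit.Theses.JParityClosure

/-- **RECORD of the dropped route copy `JParityClosure.DiluteSelfConsistency`** (shared crux
stmt-AtomisticToContinuum-3091; verbatim its ledger signature), under its former name. GUARD REMOVAL:
for every `η > 0` and all continuous positive profiles there is `σ₀ > 0` such that for `0 < σ < σ₀`
every classical hard-sphere-Euler solution on `[0, T)` tied at `t = 0` to the local Gibbs data keeps
`ρ_t(x)σ³ < η` for all `t < T` and `x`. Route JParityClosure rev 3 (2026-08-16, after the Statement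
re-type D-0032) dropped this copy; the item stays OPEN and shared (live copies:
`ImplosionDichotomy.DiluteSelfConsistency`, `OneFlightGossipEngine.…`, …; token-identical text). Kept here
solely so that `Theorems.DensityCap_of` keeps its landed signature. A record definition, not a cited fact
and not a route item (and, by the disprover's dichotomy `DenseExcursion ↔ ¬DiluteSelfConsistency`, a
statement under active refutation pressure — never asserted here). -/
def DiluteSelfConsistency : Prop :=
  ∀ η : ℝ, 0 < η → ∀ (a₀ θ₀ : Literature.MathematicalPhysics.KineticTheory.T3 → ℝ) (u₀ : Literature.MathematicalPhysics.KineticTheory.T3 → Literature.MathematicalPhysics.KineticTheory.V3), Continuous a₀ → Continuous θ₀ → Continuous u₀ → (∀ x, 0 < a₀ x) → (∀ x, 0 < θ₀ x) → ∃ σ₀ : ℝ, 0 < σ₀ ∧ ∀ σ : ℝ, 0 < σ → σ < σ₀ → ∀ (T : ℝ) (ρ θ : ℝ → Literature.MathematicalPhysics.KineticTheory.T3 → ℝ) (u : ℝ → Literature.MathematicalPhysics.KineticTheory.T3 → Literature.MathematicalPhysics.KineticTheory.V3), Literature.MathematicalPhysics.KineticTheory.IsHardSphereEulerSolution σ T ρ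 u θ → ∀ Φ : (N : ℕ) → Literature.Analysis.FluidPDE.HardSphereFlow (Literature.Analysis.FluidPDE.Torus.geometry (Fin 3)) (Literature.MathematicalPhysics.KineticTheory.hsDiameter σ N) (N + 1), Literature.MathematicalPhysics.KineticTheory.TendstoHydroFieldsAt (fun N => Literature.MathematicalPhysics.KineticTheory.localGibbsLaw σ a₀ u₀ θ₀ N (Φ N)) Φ ρ u θ 0 → ∀ t ∈ Set.Ico 0 T, ∀ x, ρ t x * σ ^ 3 < η

end Summit.AtomisticToContinuum.HydrodynamicLimit.Theses.JParityClosure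

namespace Summit.AtomisticToContinuum.HydrodynamicLimit.Theorems

open MeasureTheory Filter Set Topology
open scoped ENNReal BigOperators
open Literature.MathematicalPhysics.KineticTheory Literature.Analysis.FluidPDE
open Summit.AtomisticToContinuum.HydrodynamicLimit.Theorems.DensityCapNegative
  (cone mollDensity capEvent CapLimit densityCap_iff constState_isSolution tendstoHydroFieldsAt_homogeneous
    integral_mollDensity_eq_one integrable_mollDensity)
open Summit.AtomisticToContinuum.HydrodynamicLimit.Theorems.PolynomialCompressionPDE (Flows)

/-! ## Energy tightness from the tie -/

/-- The kinetic energy per particle is the empirical energy field tested against `χ ≡ 1`. -/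
theorem densityCap_kinEnergy_eq_empiricalEnergyField {n : ℕ} (w : Config n (Fin 3) T3) :
    (n : ℝ)⁻¹ * configEnergy w = empiricalEnergyField w (fun _ => 1) := by
  unfold empiricalEnergyField configEnergy
  rw [integral_empiricalMeasure]
  congr 1
  rw [Finset.mul_sum]
  refine Finset.sum_congr rfl fun i _ => ?_
  ring

/-- **Energy tightness from the tie** (the `χ ≡ 1` energy instance of the `t = 0` law of large
numbers — the first of the two load-bearing uses of the tie, cf. `densityCap_false_untied`): under the
local Gibbs laws the kinetic energy per particle exceeds `∫ E(0) + 1` only with vanishing probability.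
On the good set `Φ_0 = id`; the bad set is null (`gridUp_localGibbsLaw_compl_good`). -/
theorem energyTight_of_tie {σ : ℝ} {a₀ θ₀ : T3 → ℝ} {u₀ : T3 → V3} {ρ θ : ℝ → T3 → ℝ} {u : ℝ → T3 → V3}
    (Φ : Flows σ) (h0 : TendstoHydroFieldsAt (fun N => localGibbsLaw σ a₀ u₀ θ₀ N (Φ N)) Φ ρ u θ 0) :
    Tendsto (fun N => localGibbsLaw σ a₀ u₀ θ₀ N (Φ N)
      {z | (∫ x, totalEnergyDensity (ρ 0 x) (u 0 x) (θ 0 x)) + 1 < ((N + 1 : ℕ) : ℝ)⁻¹ * configEnergy z})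
      atTop (𝓝 0) := by
  set E₀ : ℝ := ∫ x, totalEnergyDensity (ρ 0 x) (u 0 x) (θ 0 x) with hE₀
  have h := (h0 (fun _ => (1 : ℝ)) continuous_const 1 one_pos).2.2
  have hE : (∫ x, (fun _ : T3 => (1 : ℝ)) x * totalEnergyDensity (ρ 0 x) (u 0 x) (θ 0 x)) = E₀ := by
    simp only [one_mul, hE₀]
  refine tendsto_of_tendsto_of_tendsto_of_le_of_le tendsto_const_nhds h (fun _ => zero_le) fun N => ?_
  set P := localGibbsLaw σ a₀ u₀ θ₀ N (Φ N) with hP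
  have hsub : {z : Config (N + 1) (Fin 3) T3 | E₀ + 1 < ((N + 1 : ℕ) : ℝ)⁻¹ * configEnergy z} ⊆
      ({z | E₀ + 1 < ((N + 1 : ℕ) : ℝ)⁻¹ * configEnergy z} ∩ (Φ N).good) ∪ (Φ N).goodᶜ := by
    intro z hz
    by_cases hg : z ∈ (Φ N).good
    · exact Or.inl ⟨hz, hg⟩
    · exact Or.inr hg
  have hincl : {z : Config (N + 1) (Fin 3) T3 | E₀ + 1 < ((N + 1 : ℕ) : ℝ)⁻¹ * configEnergy z} ∩ (Φ N).good ⊆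
      {z | (1 : ℝ) < |empiricalEnergyField ((Φ N).flow 0 z) (fun _ => (1 : ℝ)) -
        ∫ x, (fun _ : T3 => (1 : ℝ)) x * totalEnergyDensity (ρ 0 x) (u 0 x) (θ 0 x)|} := by
    rintro z ⟨hz, hg⟩
    have hz' : E₀ + 1 < ((N + 1 : ℕ) : ℝ)⁻¹ * configEnergy z := hz
    show (1 : ℝ) < |empiricalEnergyField ((Φ N).flow 0 z) (fun _ => (1 : ℝ)) -
        ∫ x, (fun _ : T3 => (1 : ℝ)) x * totalEnergyDensity (ρ 0 x) (u 0 x) (θ 0 x)|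
    rw [(Φ N).flow_zero z hg, ← densityCap_kinEnergy_eq_empiricalEnergyField, hE]
    exact lt_of_lt_of_le (by linarith) (le_abs_self _)
  calc P {z | E₀ + 1 < ((N + 1 : ℕ) : ℝ)⁻¹ * configEnergy z}
      ≤ P ({z | E₀ + 1 < ((N + 1 : ℕ) : ℝ)⁻¹ * configEnergy z} ∩ (Φ N).good) + P (Φ N).goodᶜ :=
        (measure_mono hsub).trans (measure_union_le _ _)
    _ ≤ P {z | (1 : ℝ) < |empiricalEnergyField ((Φ N).flow 0 z) (fun _ => (1 : ℝ)) -
          ∫ x, (fun _ : T3 => (1 : ℝ)) x * totalEnergyDensity (ρ 0 x) (u 0 x) (θ 0 x)|} + 0 :=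
        add_le_add (measure_mono hincl) (le_of_eq (gridUp_localGibbsLaw_compl_good σ a₀ θ₀ u₀ N (Φ N)))
    _ = _ := add_zero _

/-! ## The per-instance upgrade: fixed-time density LLN on `[0, t]` ⇒ the cap -/

/-- **The cap for ONE tied classical solution from the density LLN on `[0, t]`** (the four stubs
composed; the per-instance statement every dock of this crux shares). For a classical
hard-sphere-Euler solution `(ρ, u, θ)` on `[0, T)`, a flow family `Φ`, the `t = 0` tie and
`t ∈ [0, T)`: if at every `s ∈ [0, t]` the empirical DENSITY field converges in probability to
`∫ χ ρ(s)` for every continuous test `χ`, then `CapLimit σ a₀ u₀ θ₀ Φ ρ t` (the crux's conclusion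
block). Proof: `stub_gridUpgrade` fed with `stub_meanDisplacement` (per `N`), `energyTight_of_tie`
and `stub_eulerDensityModulus` (for `ρ`, smooth by `IsHardSphereEulerSolution.smooth_density`). -/
theorem capLimit_of_densityLLN {σ : ℝ} {a₀ θ₀ : T3 → ℝ} {u₀ : T3 → V3} {T : ℝ} {ρ θ : ℝ → T3 → ℝ}
    {u : ℝ → T3 → V3} (hE : IsHardSphereEulerSolution σ T ρ u θ) (Φ : Flows σ)
    (h0 : TendstoHydroFieldsAt (fun N => localGibbsLaw σ a₀ u₀ θ₀ N (Φ N)) Φ ρ u θ 0)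
    {t : ℝ} (ht : t ∈ Ico 0 T)
    (hlln : ∀ s ∈ Icc 0 t, ∀ χ : T3 → ℝ, Continuous χ → ∀ δ : ℝ, 0 < δ →
      Tendsto (fun N => localGibbsLaw σ a₀ u₀ θ₀ N (Φ N)
        {z | δ < |empiricalDensityField ((Φ N).flow s z) χ - ∫ x, χ x * ρ s x|}) atTop (𝓝 0)) :
    CapLimit σ a₀ u₀ θ₀ Φ ρ t :=
  stub_gridUpgrade a₀ θ₀ u₀ Φ ρ t (fun N _ hz s s' => stub_meanDisplacement (Φ N) hz s s')
    (energyTight_of_tie Φ h0) (stub_eulerDensityModulus hE.smooth_density ht) hlln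

/-! ## The crux BY NAME from the route items (conditional composition) -/

/-- **`DensityCap` from the band limit and dilute self-consistency** (kernel-checked composition of
the line `lipschitz-clock-free-past-cap`; CONDITIONAL on the route items
`ImplosionDichotomy.HydroLimitInBand` = stmt-AtomisticToContinuum-9133 and
`JParityClosure.DiluteSelfConsistency` = stmt-AtomisticToContinuum-3091, taken as hypotheses BY
NAME). Per profile `σ₀ := min σ₁ σ₃`; for a tied classical solution and `t < T`, dilute
self-consistency at `η := η₀` keeps the solution in the band `ρσ³ < η₀` on `[0, T)`, the band limit
returns the fixed-time field convergence at every `s ≤ t < T`, and `capLimit_of_densityLLN` the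
uniform-in-`(s, x)` cap (`CapLimit`, definitionally the crux's conclusion block: `densityCap_iff`).
Both load-bearing hypotheses of the crux are consumed: the tie `h0` (by the dock and by the energy
tightness) and the balance laws `hE` (by the dock and by the modulus of `ρ`). -/
theorem DensityCap_of (hB : Theses.ImplosionDichotomy.HydroLimitInBand)
    (hD : Theses.JParityClosure.DiluteSelfConsistency) : Theses.JParityClosure.DensityCap := by
  refine densityCap_iff.2 ?_
  intro a₀ θ₀ u₀ ha hθ hu ha0 hθ0
  obtain ⟨η₀, hη₀, hIB⟩ := hB
  obtain ⟨σ₁, hσ₁, h1⟩ := hIB a₀ θ₀ u₀ ha hθ hu ha0 hθ0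
  obtain ⟨σ₃, hσ₃, h3⟩ := hD η₀ hη₀ a₀ θ₀ u₀ ha hθ hu ha0 hθ0
  refine ⟨min σ₁ σ₃, lt_min hσ₁ hσ₃, ?_⟩
  intro σ hσ hσlt T ρ θ u hE Φ h0 t ht
  have hσ1 : σ < σ₁ := lt_of_lt_of_le hσlt (min_le_left _ _)
  have hσ3 : σ < σ₃ := lt_of_lt_of_le hσlt (min_le_right _ _)
  have hguard : ∀ t ∈ Ico 0 T, ∀ x, ρ t x * σ ^ 3 < η₀ := h3 σ hσ hσ3 T ρ θ u hE Φ h0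
  refine capLimit_of_densityLLN hE Φ h0 ht ?_
  intro s hs χ hχ δ hδ
  exact (h1 σ hσ hσ1 T ρ θ u hE hguard Φ h0 s ⟨hs.1, lt_of_le_of_lt hs.2 ht.2⟩ χ hχ δ hδ).1

/-- **The corollary status of the crux after the Statement re-type (D-0032):
`HydrodynamicLimit → DiluteSelfConsistency → DensityCap`.** Since 2026-08-16 the summit conjunct
`_root_.HydrodynamicLimit` IS the packing-guarded limit (verbatim `ImplosionDichotomy.HydroLimitInBand`,
definitionally), so the crux follows from the conjunct together with guard removal (stmt-3091) — this is
`DensityCap_of` with the conjunct in the slot of stmt-9133. CONDITIONAL on both. (Before the re-type the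
conjunct was unguarded and gave the crux alone: the disprover's §6 near-miss, landed as
`densityCap_of_hydrodynamicLimit`, now this theorem's deprecated alias.) -/
theorem densityCap_of_hydrodynamicLimit_of_diluteSelfConsistency (hHL : _root_.HydrodynamicLimit)
    (hD : Theses.JParityClosure.DiluteSelfConsistency) : Theses.JParityClosure.DensityCap :=
  DensityCap_of hHL hD

/-- Pre-re-type corollary `HydrodynamicLimit → DensityCap` (landed p83594 against the UNGUARDED conjunct:
"a refutation of the crux would refute the conjunct"). Since the Statement re-type D-0032 (2026-08-16)
`_root_.HydrodynamicLimit` is packing-guarded, the old proof no longer elaborates and the old reading no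
longer holds by bookkeeping (it would remove the guard, i.e. prove stmt-3091's content); the name is kept
(append-only) as an alias of the honest re-typed corollary
`densityCap_of_hydrodynamicLimit_of_diluteSelfConsistency`. From the conjunct ALONE see
`densityCapGuarded_of_hydrodynamicLimit`. -/
@[deprecated densityCap_of_hydrodynamicLimit_of_diluteSelfConsistency (since := "2026-08-17")]
alias densityCap_of_hydrodynamicLimit := densityCap_of_hydrodynamicLimit_of_diluteSelfConsistency

/-- **The 3091-free content: the packing-GUARDED cap from the band limit alone** (CONDITIONAL on
stmt-9133 only). With the packing guard `ρσ³ < η₀` on `[0, T)` added to the crux's hypotheses — the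
form in which the glue `ParityInBand` actually consumes the cap, and the planner's repair target
recommended by the disprover (§8: the UNGUARDED crux proves a `σ`-uniform packing band, i.e. it
inherits stmt-3091's implosion hazard) — the cap follows from `HydroLimitInBand` by the same upgrade,
with the band statement's own `η₀` and `σ₀`. -/
theorem densityCapGuarded_of_hydroLimitInBand (hB : Theses.ImplosionDichotomy.HydroLimitInBand) :
    ∃ η₀ : ℝ, 0 < η₀ ∧ ∀ (a₀ θ₀ : T3 → ℝ) (u₀ : T3 → V3), Continuous a₀ → Continuous θ₀ → Continuous u₀ →
      (∀ x, 0 < a₀ x) → (∀ x, 0 < θ₀ x) → ∃ σ₀ : ℝ, 0 < σ₀ ∧ ∀ σ : ℝ, 0 < σ → σ < σ₀ →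
      ∀ (T : ℝ) (ρ θ : ℝ → T3 → ℝ) (u : ℝ → T3 → V3), IsHardSphereEulerSolution σ T ρ u θ →
      (∀ t ∈ Ico 0 T, ∀ x, ρ t x * σ ^ 3 < η₀) →
      ∀ Φ : Flows σ, TendstoHydroFieldsAt (fun N => localGibbsLaw σ a₀ u₀ θ₀ N (Φ N)) Φ ρ u θ 0 →
      ∀ t ∈ Ico 0 T, CapLimit σ a₀ u₀ θ₀ Φ ρ t := by
  obtain ⟨η₀, hη₀, hIB⟩ := hB
  refine ⟨η₀, hη₀, ?_⟩
  intro a₀ θ₀ u₀ ha hθ hu ha0 hθ0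
  obtain ⟨σ₁, hσ₁, h1⟩ := hIB a₀ θ₀ u₀ ha hθ hu ha0 hθ0
  refine ⟨σ₁, hσ₁, ?_⟩
  intro σ hσ hσlt T ρ θ u hE hguard Φ h0 t ht
  refine capLimit_of_densityLLN hE Φ h0 ht ?_
  intro s hs χ hχ δ hδ
  exact (h1 σ hσ hσlt T ρ θ u hE hguard Φ h0 s ⟨hs.1, lt_of_le_of_lt hs.2 ht.2⟩ χ hχ δ hδ).1

/-- **What the re-typed conjunct ALONE gives: the packing-GUARDED cap.** Since the Statement re-type
D-0032 the conjunct `_root_.HydrodynamicLimit` is verbatim the packing-guarded limit, so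
`densityCapGuarded_of_hydroLimitInBand` applies to it as it stands (definitional unfolding): for profiles,
small `σ`, tied classical solutions that stay in the band `ρσ³ < η₀` on `[0, T)`, the cap holds on every
`[0, t]`, `t < T`. CONDITIONAL on the summit conjunct only. -/
theorem densityCapGuarded_of_hydrodynamicLimit (hHL : _root_.HydrodynamicLimit) :
    ∃ η₀ : ℝ, 0 < η₀ ∧ ∀ (a₀ θ₀ : T3 → ℝ) (u₀ : T3 → V3), Continuous a₀ → Continuous θ₀ → Continuous u₀ →
      (∀ x, 0 < a₀ x) → (∀ x, 0 < θ₀ x) → ∃ σ₀ : ℝ, 0 < σ₀ ∧ ∀ σ : ℝ, 0 < σ → σ < σ₀ →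
      ∀ (T : ℝ) (ρ θ : ℝ → T3 → ℝ) (u : ℝ → T3 → V3), IsHardSphereEulerSolution σ T ρ u θ →
      (∀ t ∈ Ico 0 T, ∀ x, ρ t x * σ ^ 3 < η₀) →
      ∀ Φ : Flows σ, TendstoHydroFieldsAt (fun N => localGibbsLaw σ a₀ u₀ θ₀ N (Φ N)) Φ ρ u θ 0 →
      ∀ t ∈ Ico 0 T, CapLimit σ a₀ u₀ θ₀ Φ ρ t :=
  densityCapGuarded_of_hydroLimitInBand hHL

/-! ## The converse: by equal mass the one-sided cap is the two-sided uniform `L¹` law -/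

/-- **One-sided bound + equal mass ⇒ `L¹` bound** (on the Haar probability space `𝕋³`): if `f, g` are
integrable with `∫ f = ∫ g` and `f ≤ g + η` everywhere, then `∫ |f − g| ≤ 2η`
(`|f − g| = 2 (f − g)₊ − (f − g)` and `(f − g)₊ ≤ η`). -/
theorem integral_abs_sub_le_of_cap {f g : T3 → ℝ} (hf : Integrable f volume) (hg : Integrable g volume)
    (hint : ∫ x, f x = ∫ x, g x) {η : ℝ} (hη : 0 ≤ η) (hcap : ∀ x, f x ≤ g x + η) :
    ∫ x, |f x - g x| ≤ 2 * η := by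
  have hpos : Integrable (fun x => max (f x - g x) 0) volume := (hf.sub hg).pos_part
  have hid : ∀ x, |f x - g x| = 2 * max (f x - g x) 0 - (f x - g x) := by
    intro x
    rcases le_total 0 (f x - g x) with h | h
    · rw [abs_of_nonneg h, max_eq_left h]; ring
    · rw [abs_of_nonpos h, max_eq_right h]; ring
  have hle : ∀ x, max (f x - g x) 0 ≤ η := fun x => max_le (by linarith [hcap x]) hη
  have hfg : Integrable (fun x => f x - g x) volume := hf.sub hg
  have hpos2 : Integrable (fun x => 2 * max (f x - g x) 0) volume := hpos.const_mul 2
  have hint2 : ∫ x, max (f x - g x) 0 ≤ ∫ _x : T3, η := integral_mono hpos (integrable_const η) hle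
  calc ∫ x, |f x - g x| = ∫ x, (2 * max (f x - g x) 0 - (f x - g x)) := integral_congr_ae (ae_of_all _ hid)
    _ = 2 * (∫ x, max (f x - g x) 0) - ((∫ x, f x) - ∫ x, g x) := by
        rw [integral_sub hpos2 hfg, integral_const_mul, integral_sub hf hg]
    _ ≤ 2 * ∫ _x : T3, η := by
        rw [hint, sub_self, sub_zero]
        exact mul_le_mul_of_nonneg_left hint2 (by norm_num)
    _ = 2 * η := by
        rw [integral_const, smul_eq_mul, measureReal_def, measure_univ, ENNReal.toReal_one, one_mul]

/-- **`DensityCap` ⇒ the two-sided, uniform-in-time `L¹` density law of large numbers** (the converse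
direction of the dock; CONDITIONAL on the crux). For a tied classical solution, `σ < σ₀ ∧ 1/2`,
`t < T`, `η, δ > 0`: for all `r < r₀ ∧ 1/2` and eventually in `N`, with `P_N`-probability `≥ 1 − δ`,
`∫ |ρ̄ʳ(Φ_N(s) z)(x) − ρ(s, x)| dx ≤ 2η` for EVERY `s ∈ [0, t]`. Off the overshoot event the one-sided
bound holds everywhere, and both densities have mass one (`integral_mollDensity_eq_one`;
`integral_density_eq` + `integral_density_zero_eq_one`), so `integral_abs_sub_le_of_cap` applies. -/
theorem uniformL1_of_densityCap (hDC : Theses.JParityClosure.DensityCap) :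
    ∀ (a₀ θ₀ : T3 → ℝ) (u₀ : T3 → V3), Continuous a₀ → Continuous θ₀ → Continuous u₀ →
      (∀ x, 0 < a₀ x) → (∀ x, 0 < θ₀ x) → ∃ σ₀ : ℝ, 0 < σ₀ ∧ ∀ σ : ℝ, 0 < σ → σ < σ₀ →
      ∀ (T : ℝ) (ρ θ : ℝ → T3 → ℝ) (u : ℝ → T3 → V3), IsHardSphereEulerSolution σ T ρ u θ →
      ∀ Φ : Flows σ, TendstoHydroFieldsAt (fun N => localGibbsLaw σ a₀ u₀ θ₀ N (Φ N)) Φ ρ u θ 0 →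
      ∀ t ∈ Ico 0 T, ∀ η δ : ℝ, 0 < η → 0 < δ → ∃ r₀ : ℝ, 0 < r₀ ∧ ∀ r : ℝ, 0 < r → r < r₀ →
        ∃ N₀ : ℕ, ∀ N : ℕ, N₀ ≤ N → localGibbsLaw σ a₀ u₀ θ₀ N (Φ N)
          {z | ∃ s ∈ Icc 0 t, 2 * η < ∫ x, |mollDensity r ((Φ N).flow s z) x - ρ s x|} ≤
            ENNReal.ofReal δ := by
  intro a₀ θ₀ u₀ ha hθ hu ha0 hθ0
  obtain ⟨σ₀, hσ₀, h⟩ := densityCap_iff.1 hDC a₀ θ₀ u₀ ha hθ hu ha0 hθ0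
  refine ⟨min σ₀ (1 / 2), lt_min hσ₀ one_half_pos, ?_⟩
  intro σ hσ hσlt T ρ θ u hE Φ h0 t ht η δ hη hδ
  have hσ0 : σ < σ₀ := lt_of_lt_of_le hσlt (min_le_left _ _)
  have hσ2 : σ ≤ 1 / 2 := (lt_of_lt_of_le hσlt (min_le_right _ _)).le
  obtain ⟨r₀, hr₀, hr⟩ := h σ hσ hσ0 T ρ θ u hE Φ h0 t ht η δ hη hδ
  refine ⟨min r₀ (1 / 2), lt_min hr₀ one_half_pos, fun r hrpos hrlt => ?_⟩
  have hrr₀ : r < r₀ := lt_of_lt_of_le hrlt (min_le_left _ _)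
  have hr2 : r ≤ 1 / 2 := (lt_of_lt_of_le hrlt (min_le_right _ _)).le
  obtain ⟨N₀, hN⟩ := hr r hrpos hrr₀
  refine ⟨N₀, fun N hNN₀ => le_trans (measure_mono ?_) (hN N hNN₀)⟩
  -- off the overshoot event the `L¹` distance is at most `2η` at every `s ∈ [0, t]`
  rintro z ⟨s, hs, hL1⟩
  by_contra hz
  have hcap : ∀ x, mollDensity r ((Φ N).flow s z) x ≤ ρ s x + η := by
    intro x
    by_contra hx
    exact hz ⟨s, hs, x, lt_of_not_ge hx⟩
  have hsT : s ∈ Ico 0 T := ⟨hs.1, lt_of_le_of_lt hs.2 ht.2⟩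
  have hmass : ∫ x, ρ s x = 1 := by
    rw [DenseExcursionEverywhere.integral_density_eq hE hsT]
    exact DenseExcursionEverywhere.integral_density_zero_eq_one hσ2 ha hθ hu ha0 hθ0 Φ h0
  have hρint : Integrable (ρ s) volume :=
    ((hE.smooth_density.isSmooth_slice hsT).continuous).integrable_unitAddTorus
  have hle := integral_abs_sub_le_of_cap (integrable_mollDensity hrpos _) hρint
    (by rw [hmass, integral_mollDensity_eq_one hrpos hr2 (Nat.succ_ne_zero N)]) hη.le hcap
  exact absurd hL1 (not_lt.2 hle)

/-! ## The equilibrium instance (unconditional) -/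

/-- **The cap holds at global equilibrium, unconditionally** (the disprover's near-miss
`capLimit_homogeneous`, now proved). For the homogeneous profiles `(a₀, θ₀, u₀) = (1, 1, 0)` there is
`σ₁ > 0` such that for `0 < σ < σ₁`, every flow family `Φ` and every `t ≥ 0`, the conclusion block of the
crux holds for the tied constant Euler state `ρ ≡ 1`: the homogeneous local Gibbs law is flow-invariant,
so its empirical fields converge at EVERY time (`tendstoHydroFieldsAt_homogeneous`), and
`capLimit_of_densityLLN` (constant states are classical solutions on every `[0, T)`,
`constState_isSolution`) upgrades the density component to the uniform cap on `[0, t]`. -/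
theorem capLimit_homogeneous :
    ∃ σ₁ : ℝ, 0 < σ₁ ∧ ∀ σ : ℝ, 0 < σ → σ < σ₁ → ∀ Φ : Flows σ, ∀ t : ℝ, 0 ≤ t →
      CapLimit σ (fun _ => 1) (fun _ => 0) (fun _ => 1) Φ (fun _ _ => 1) t := by
  obtain ⟨σ₁, hσ₁, -, H⟩ := tendstoHydroFieldsAt_homogeneous
  refine ⟨σ₁, hσ₁, fun σ hσ hσ1 Φ t ht => ?_⟩
  have hE := constState_isSolution σ (t + 1) (c := 1) (θc := 1) one_pos one_pos
  refine capLimit_of_densityLLN hE Φ (H σ hσ hσ1 Φ 0) (t := t) ⟨ht, by linarith⟩ ?_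
  intro s _ χ hχ δ hδ
  exact (H σ hσ hσ1 Φ s χ hχ δ hδ).1

end Summit.AtomisticToContinuum.HydrodynamicLimit.Theorems

end
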